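import Summits.FinalStateConjecture.FinalStateConjecture.Theorems.WeakCosmicCensorshipMGHD.Negative.HamiltonianConstraintFamily

/-!
# `WeakCosmicCensorshipMGHD` (crux `stmt-FinalStateConjecture-9952`), negative-side support II:
# the vacuum-constraint clause of admissibility is load-bearing — without it Christodoulou's
# typed genericity FAILS

Support file of the crux disprover (cdisprove seat, cycle 2), `sorry`-free, no named facts.
The crux is Christodoulou-genericity (codimension `≥ 1`, curve form, relative to the admissible
class `admissibleVacuumData Σ`) of "an MGHD exists and every MGHD has complete `𝓘⁺`". This file
proves that the clause `D.IsVacuumConstraintSolution` of admissibility is LOAD-BEARING in the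
strongest sense available to a disprover: the crux with that clause deleted from the admissible
class (everything else verbatim) is FALSE (`wcc_false_without_constraints`). Mechanism — the one
a refutation of the crux itself would have to exhibit — an exceptional datum that TRAPS every
jointly smooth curve through it:

* §3 (witness) `bumpData = (ℝ³, δ, k = ψ(‖y‖²) δ)` with a smooth bump `ψ`, `ψ = 1` near `0`,
  `ψ = 0` for `‖y‖² ≥ 1/2`: complete, one strongly asymptotically flat end of mass `0`
  (`bumpData_mem_admissibleNoConstraint`), Hamiltonian constraint function `6` at the origin, so
  no vacuum Cauchy development (`isEmpty_vacuumCauchyDevelopment_bumpData`, by §1 of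
  `HamiltonianConstraintFamily.lean`).
* §4 `wcc_false_without_constraints`: along every jointly smooth family through `bumpData` the
  Hamiltonian constraint function at the origin is continuous in the parameter (§2 of
  `HamiltonianConstraintFamily.lean`) with value `6` at `0`, so all members with small nonzero
  parameter violate the constraint and are exceptional: the exceptional set of the
  constraint-free class has NOT codimension `≥ 1` at `bumpData`, on `Σ = ℝ³`. (The admissible
  class itself is untouched: it is contained in the constraint-free class,
  `admissibleVacuumData_subset_admissibleNoConstraint`, and `bumpData ∉ admissibleVacuumData`.)

## References

* D. Christodoulou, CQG 16 (1999) A23, p. A24 (admissible class, families of data).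
* Y. Choquet-Bruhat, *General Relativity and the Einstein Equations* (2009), Ch. VI, Thm. 3.3.
* D. Christodoulou, S. Klainerman, *The global nonlinear stability of the Minkowski space* (1993),
  (1.0.9) (strong asymptotic flatness of the trivial data).
-/

noncomputable section

-- instance search through nested operator types (as in the tree's coordinate-calculus files)
set_option maxSynthPendingDepth 3

open Bundle TopologicalSpace Manifold Set Function Filter Metric
open scoped ContDiff Topology InnerProductSpace RealInnerProductSpace

namespace Summit.FinalStateConjecture.FinalStateConjecture.Theorems.WeakCosmicCensorshipMGHD.Negative

open Literature.Geometry.Lorentzian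
open Summit.FinalStateConjecture.FinalStateConjecture.Theorems.TameCensorship.Negative

/-! ## §3 The witness: flat metric, `k = ψ(‖y‖²) δ` with a bump `ψ` -/

/-- The bump profile `ψ(t) = smoothTransition (2 − 4t)`: smooth, `= 1` for `t ≤ 1/4`, `= 0` for
`t ≥ 1/2`. -/
def ψ (t : ℝ) : ℝ := Real.smoothTransition (2 - 4 * t)

/-- `ψ` is smooth. -/
theorem contDiff_ψ : ContDiff ℝ ∞ ψ :=
  Real.smoothTransition.contDiff.comp (contDiff_const.sub (contDiff_const.mul contDiff_id))

/-- `ψ(0) = 1`. -/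
@[simp] theorem ψ_zero : ψ 0 = 1 :=
  Real.smoothTransition.one_of_one_le (by norm_num)

/-- `ψ(t) = 0` for `t ≥ 1/2`. -/
theorem ψ_of_half_le {t : ℝ} (h : 1 / 2 ≤ t) : ψ t = 0 :=
  Real.smoothTransition.zero_of_nonpos (by linarith)

/-- The ambient section `y ↦ ψ(‖y‖²) δ` is smooth. -/
theorem contDiff_bumpSection :
    ContDiff ℝ ∞ fun y : E3 ↦ ψ (‖y‖ ^ 2) • (innerSL ℝ (E := E3) : Bil) :=
  (contDiff_ψ.comp (contDiff_norm_sq ℝ)).smul contDiff_const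

/-- **The witness `bumpData = (ℝ³, δ, ψ(‖y‖²) δ)`**: flat metric, `k` a compactly supported
multiple of `δ` equal to `δ` near the origin. -/
def bumpData : SliceData where
  h := Minkowski.flatMetric
  k x := ofBil x (ψ (‖(x : E3)‖ ^ 2) • (innerSL ℝ (E := E3) : Bil))
  k_symm x v w := congrArg (fun r : ℝ ↦ ψ (‖(x : E3)‖ ^ 2) * r) (real_inner_comm (F := E3) w v)
  contMDiff_k := (contMDiff_section_iff fun x : Minkowski.slice ↦
      ψ (‖(x : E3)‖ ^ 2) • (innerSL ℝ (E := E3) : Bil)).2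
    (contDiff_bumpSection.comp_contMDiff contMDiff_subtype_val)

/-- `bumpData` has the flat metric of `trivialData` (by `rfl`). -/
theorem bumpData_metric : bumpData.metric = trivialData.metric := rfl

/-- Evaluation of `k`. -/
@[simp] theorem bumpData_k_apply (x : Minkowski.slice) (v w : E3) :
    bumpData.k x v w = ψ (‖(x : E3)‖ ^ 2) * ⟪v, w⟫ := rfl

/-- The origin of the slice. -/
def origin : Minkowski.slice := ⟨0, Minkowski.mem_slice 0⟩

/-- The origin has coordinates `0`. -/
@[simp] theorem coe_origin : ((origin : Minkowski.slice) : E3) = 0 := rfl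

/-- At the origin `k = δ = h`. -/
theorem bumpData_kBilin_origin : bumpData.kBilin origin = bumpData.metric.toBilinForm origin := by
  refine LinearMap.BilinForm.ext fun v w ↦ ?_
  show ψ (‖(0 : E3)‖ ^ 2) * @inner ℝ E3 _ v w = @inner ℝ E3 _ v w
  simp

/-- `tr_h k = 3` at the origin. -/
theorem bumpData_traceK_origin : bumpData.traceK origin = 3 := by
  rw [InitialDataSet.traceK, bumpData_kBilin_origin, PseudoRiemannianMetric.trace_toBilinForm_eq,
    finrank_euclideanSpace_fin]
  norm_num

/-- `|k|²_h = 3` at the origin. -/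
theorem bumpData_normSqK_origin : bumpData.normSqK origin = 3 := by
  rw [InitialDataSet.normSqK, bumpData_kBilin_origin, PseudoRiemannianMetric.normSq]
  have hflip : (bumpData.metric.toBilinForm origin).flip = bumpData.metric.toBilinForm origin := by
    ext v w
    exact bumpData.metric.symm origin w v
  rw [hflip, PseudoRiemannianMetric.sharp_comp_toBilinForm]
  show LinearMap.trace ℝ E3 (LinearMap.id ∘ₗ LinearMap.id) = 3
  rw [LinearMap.id_comp, LinearMap.trace_id, finrank_euclideanSpace_fin]
  norm_num

/-- **The Hamiltonian constraint function of `bumpData` at the origin is `6`** (`R(δ) = 0`,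
`|k|² = 3`, `(tr k)² = 9`), under any Levi-Civita instance. -/
theorem bumpData_hamiltonianConstraintFn_origin [bumpData.metric.HasLeviCivita] :
    bumpData.hamiltonianConstraintFn origin = 6 := by
  rw [InitialDataSet.hamiltonianConstraintFn, bumpData_traceK_origin, bumpData_normSqK_origin]
  haveI : trivialData.metric.HasLeviCivita := ‹bumpData.metric.HasLeviCivita›
  have h0 : bumpData.metric.scalarCurvature origin = 0 := trivialData_scalarCurvature_eq_zero origin
  rw [h0]
  norm_num

/-- `bumpData` has no vacuum Cauchy development. -/
theorem isEmpty_vacuumCauchyDevelopment_bumpData : IsEmpty (VacuumCauchyDevelopment bumpData) := by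
  haveI := bumpData.metric.hasLeviCivita
  exact isEmpty_vacuumCauchyDevelopment_of_hamiltonianConstraintFn_ne_zero (y := origin)
    (by rw [bumpData_hamiltonianConstraintFn_origin]; norm_num)

/-- `bumpData` violates the vacuum constraints, so it is NOT admissible. -/
theorem bumpData_not_mem_admissibleVacuumData : bumpData ∉ admissibleVacuumData Minkowski.slice := by
  intro h
  haveI := bumpData.metric.hasLeviCivita
  have hc := (h.1.1 origin).1
  rw [bumpData_hamiltonianConstraintFn_origin] at hc
  norm_num at hc

/-- The chart components of `k` on the end `trivialAFEnd` vanish identically (`k = 0` for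
`‖y‖² ≥ 1/2`, in particular on the end `{1 < ‖y‖}`; junk value `0` inside the unit ball). -/
theorem kCoeff_bumpData (x : E3) : AFEnd.kCoeff trivialAFEnd bumpData x = 0 := by
  unfold AFEnd.kCoeff
  split_ifs with hx
  · ext v w
    rw [pullbackBilin_apply]
    have hx1 : (1 : ℝ) < ‖x‖ := hx
    have hnorm : ‖((trivialAFEnd.dataChart ⟨x, hx⟩ : Minkowski.slice) : E3)‖ = ‖x‖ := rfl
    have hψ : ψ (‖((trivialAFEnd.dataChart ⟨x, hx⟩ : Minkowski.slice) : E3)‖ ^ 2) = 0 := by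
      rw [hnorm]
      exact ψ_of_half_le (by nlinarith)
    show ψ (‖((trivialAFEnd.dataChart ⟨x, hx⟩ : Minkowski.slice) : E3)‖ ^ 2) * _ = 0
    rw [hψ, zero_mul]
  · rfl

/-- **`bumpData` is admissible but for the constraints**: complete (it has the flat metric), with
the sole end `trivialAFEnd` of `ℝ³`, on which it is strongly asymptotically flat of mass `0`
(metric components those of the trivial data, `k`-components identically `0`).
[cite: Christodoulou1999, p. A24] -/
theorem bumpData_mem_admissibleNoConstraint :
    (∀ [bumpData.metric.HasLeviCivita], bumpData.IsComplete) ∧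
      ∃ (e : AFEnd Minkowski.slice) (M : ℝ), e.IsSoleEnd ∧
        e.IsStronglyAsymptoticallyFlatDR bumpData M := by
  refine ⟨fun {inst} ↦ ?_, trivialAFEnd, 0, isSoleEnd_trivialAFEnd, ?_, ?_⟩
  · haveI : trivialData.metric.HasLeviCivita := inst
    exact isComplete_trivialData_holds
  · exact trivialAFEnd_isStronglyAsymptoticallyFlatCK_holds.isStronglyAsymptoticallyFlatDR.1
  · intro m _
    refine isLittleO_norm_iteratedFDeriv_of_forall_eq_zero (fun y ↦ ?_) m _ _
    exact kCoeff_bumpData y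

/-! ## §4 The constraint clause is load-bearing: the constraint-free crux is false -/

section Statement

variable (X : Type) [TopologicalSpace X] [ChartedSpace E3 X] [IsManifold (𝓡 3) ∞ X]

/-- The admissible class with the vacuum-constraint clause deleted (everything else verbatim
`admissibleVacuumData`): complete data with one strongly asymptotically flat end. -/
def admissibleNoConstraint : Set (InitialDataSet (𝓡 3) X) :=
  {D | (∀ [D.metric.HasLeviCivita], D.IsComplete) ∧
    ∃ (e : AFEnd X) (M : ℝ), e.IsSoleEnd ∧ e.IsStronglyAsymptoticallyFlatDR D M}

variable {X}

/-- The weakening is a weakening: admissible data are constraint-free admissible. -/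
theorem admissibleVacuumData_subset_admissibleNoConstraint :
    admissibleVacuumData X ⊆ admissibleNoConstraint X :=
  fun _ hD ↦ ⟨fun {_} ↦ hD.1.2, hD.2⟩

end Statement

/-- Nonzero multiples of `e₁` are nonzero in `ℝ¹`. -/
theorem smul_single_ne_zero {t : ℝ} (ht : t ≠ 0) :
    t • EuclideanSpace.single (0 : Fin 1) (1 : ℝ) ≠ 0 := by
  intro h
  have := congrArg (fun c : EuclideanSpace ℝ (Fin 1) ↦ c 0) h
  simp [ht] at this

section Trap

variable {F : EuclideanSpace ℝ (Fin 1) → SliceData}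

/-- **Trapping, step 1.** Along a smooth family through `bumpData` the Hamiltonian constraint
function at the origin is `≠ 0` for all parameters near `0` (it is continuous in the parameter,
`continuous_hamiltonianConstraintFn_family`, with value `6` at `0`). [cite: Christodoulou1999, p. A24] -/
theorem eventually_hamiltonianConstraintFn_ne_zero (hF : InitialDataSet.IsSmoothDataFamily 1 F)
    (h0 : F 0 = bumpData) :
    ∀ᶠ t in 𝓝 (0 : ℝ),
      (haveI := (F (t • EuclideanSpace.single (0 : Fin 1) (1 : ℝ))).metric.hasLeviCivita;
        (F (t • EuclideanSpace.single (0 : Fin 1) (1 : ℝ))).hamiltonianConstraintFn origin) ≠ 0 := by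
  have h2 : Continuous fun t : ℝ ↦ ((0 : E3), t) := continuous_const.prodMk continuous_id
  have hfc' := (continuous_hamiltonianConstraintFn_family hF).comp h2
  -- (stated pointwise: unifying `Continuous (g ∘ f)` with the target directly is expensive)
  have hfc : Continuous fun t : ℝ ↦
      (haveI := (F (t • EuclideanSpace.single (0 : Fin 1) (1 : ℝ))).metric.hasLeviCivita;
        (F (t • EuclideanSpace.single (0 : Fin 1) (1 : ℝ))).hamiltonianConstraintFn origin) :=
    hfc'.congr fun t ↦ rfl
  have hf0 : (haveI := (F ((0 : ℝ) • EuclideanSpace.single (0 : Fin 1) (1 : ℝ))).metric.hasLeviCivita;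
      (F ((0 : ℝ) • EuclideanSpace.single (0 : Fin 1) (1 : ℝ))).hamiltonianConstraintFn origin) = 6 := by
    have key : ∀ D : SliceData, D = bumpData →
        (haveI := D.metric.hasLeviCivita; D.hamiltonianConstraintFn origin) = 6 := by
      rintro D rfl
      haveI := bumpData.metric.hasLeviCivita
      exact bumpData_hamiltonianConstraintFn_origin
    refine key _ ?_
    rw [zero_smul]
    exact h0
  refine hfc.continuousAt.eventually_ne ?_
  beta_reduce
  rw [hf0]
  norm_num

/-- **Trapping, step 2.** Hence the members of the family with parameter near `0` have no
vacuum Cauchy development (Gauss, §1). [cite: ChoquetBruhat2009, Ch. VI, Thm. 3.3] -/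
theorem eventually_isEmpty_vacuumCauchyDevelopment (hF : InitialDataSet.IsSmoothDataFamily 1 F)
    (h0 : F 0 = bumpData) :
    ∀ᶠ t in 𝓝 (0 : ℝ),
      IsEmpty (VacuumCauchyDevelopment (F (t • EuclideanSpace.single (0 : Fin 1) (1 : ℝ)))) :=
  (eventually_hamiltonianConstraintFn_ne_zero hF h0).mono fun _ ht ↦
    isEmpty_vacuumCauchyDevelopment_of_ne_zero ht

/-- **Trapping, step 3.** Every smooth family through `bumpData` has a member at a NONZERO
parameter without vacuum Cauchy development. -/
theorem exists_ne_zero_isEmpty_vacuumCauchyDevelopment (hF : InitialDataSet.IsSmoothDataFamily 1 F)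
    (h0 : F 0 = bumpData) :
    ∃ c : EuclideanSpace ℝ (Fin 1), c ≠ 0 ∧ IsEmpty (VacuumCauchyDevelopment (F c)) := by
  obtain ⟨ε, hε, hball⟩ := Metric.eventually_nhds_iff.1
    (eventually_isEmpty_vacuumCauchyDevelopment hF h0)
  refine ⟨(ε / 2) • EuclideanSpace.single (0 : Fin 1) (1 : ℝ),
    smul_single_ne_zero (half_pos hε).ne', hball ?_⟩
  rw [Real.dist_eq, sub_zero, abs_of_pos (half_pos hε)]
  exact half_lt_self hε

end Trap

/-- **The vacuum-constraint clause of admissibility is load-bearing: without it the crux is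
FALSE.** The statement in the conclusion is `WeakCosmicCensorshipMGHD` with the admissible class
`admissibleVacuumData X` replaced by `admissibleNoConstraint X` (the clause
`D.IsVacuumConstraintSolution` deleted, everything else verbatim). It fails at `X = ℝ³`,
`D = bumpData`: the datum is constraint-free admissible (`bumpData_mem_admissibleNoConstraint`) and
exceptional (no vacuum Cauchy development, `isEmpty_vacuumCauchyDevelopment_bumpData`), and it is
TRAPPED — along every jointly smooth family `F` through it the Hamiltonian constraint function at
the origin is continuous in the parameter with value `6` at the parameter `0`, so all members
with small nonzero parameter violate the constraint, have no vacuum Cauchy development (Gauss,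
§1) and are exceptional (`exists_ne_zero_isEmpty_vacuumCauchyDevelopment`): no curve escapes.
[cite: Christodoulou1999, p. A24] [cite: ChoquetBruhat2009, Ch. VI, Thm. 3.3] -/
theorem wcc_false_without_constraints :
    ¬ ∀ (X : Type) [TopologicalSpace X] [ChartedSpace E3 X]
      [IsManifold (𝓡 3) ∞ X] [T2Space X] [SecondCountableTopology X] [ConnectedSpace X],
      InitialDataSet.IsChristodoulouGeneric (admissibleNoConstraint X)
        (fun D ↦ (∃ 𝒟 : VacuumCauchyDevelopment D, 𝒟.IsMaximal) ∧
          ∀ 𝒟 : VacuumCauchyDevelopment D, 𝒟.IsMaximal →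
            _root_.Summit.FinalStateConjecture.HasCompleteNullInfinity 𝒟.toCauchyDevelopment) 1 := by
  intro hW
  have hexc0 : ¬ ((∃ 𝒟 : VacuumCauchyDevelopment bumpData, 𝒟.IsMaximal) ∧
      ∀ 𝒟 : VacuumCauchyDevelopment bumpData, 𝒟.IsMaximal →
        _root_.Summit.FinalStateConjecture.HasCompleteNullInfinity 𝒟.toCauchyDevelopment) := by
    rintro ⟨⟨𝒟, -⟩, -⟩
    exact isEmpty_vacuumCauchyDevelopment_bumpData.false 𝒟
  obtain ⟨F, hF, h0, -, hadm, hexc⟩ :=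
    hW Minkowski.slice bumpData ⟨bumpData_mem_admissibleNoConstraint, hexc0⟩
  obtain ⟨c, hc, hempty⟩ := exists_ne_zero_isEmpty_vacuumCauchyDevelopment hF h0
  refine hexc c hc ⟨hadm c, ?_⟩
  rintro ⟨⟨𝒟, -⟩, -⟩
  exact hempty.false 𝒟

end Summit.FinalStateConjecture.FinalStateConjecture.Theorems.WeakCosmicCensorshipMGHD.Negative

end
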